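import Literature.AlgebraicGeometry.Resolution.AbhyankarToroidalChartsEtale
import Literature.AlgebraicGeometry.Resolution.UnramifiedDefectlessGenerator
import HarnessLib

/-!
# Temkin 2013, Thm. 5.5.1 (iii): "`K°` is étale over `K°_B`" from the generalized stability theorem

Topic: `Literature/AlgebraicGeometry/Resolution`. The named fact `Temkin2013_Thm551iii_inertial`
(`AbhyankarToroidalChartsEtale.lean`; M. Temkin, *Inseparable local uniformization*, J. Algebra
373 (2013) 65–119 = arXiv:0804.1554v3, proof of Thm. 5.5.1 (iii), p. 59: "In this case, the
extension `K/K_B` is unramified because `K_B` is stable by Remark 2.1.3, `|K_B^×| = |K^×|` and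
`K̃` is separable over `k(B̃_F) = K̃_B`. Since `K°_B` is the union of the rings `O_M` by
Lemma 5.4.2 and `K°` is étale over `K°_B` …") is PROVED here from the generalized stability
theorem (Remark 2.1.3 of the source = the tree's named fact `Kuhlmann2010Stability`,
`ValuationDefect.lean`, Kuhlmann 2010, Thm. 1.1, itself reduced in the tree to
`Kuhlmann2010StabilityRational` / `Kuhlmann2010StabilityValueTranscendental`):

* `Temkin2013_Thm551iii_inertial.of_stability` — PROVED:
  `Kuhlmann2010Stability → Temkin2013_Thm551iii_inertial`. For an Abhyankar basis `B = x ⊔ y`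
  of the finitely generated `K/k` with `D_{K/k} = 0`, `|x|` generating `Λ = |K^×|` and `K̃`
  separable over `k(ỹ)`: `K_B = k(B)` is finitely generated with `D_{K_B/k} = 0` (its `E` and `F`
  are those of `K`, `TranscendentallyImmediate.lean`, and `tr.deg = E + F`), hence a defectless
  field by the stability theorem; `|K_B^×| = |K^×|` as the `|x_j| ∈ |K_B^×|` generate; `K̃` is
  separable over `κ(O ∩ K_B) ⊇ k(ỹ)`; so `exists_generator_valuation_derivative_eq_one`
  (`UnramifiedDefectlessGenerator.lean`) gives `η ∈ K°` with `K = K_B(η)` and minimal polynomial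
  `f ∈ (K_B ∩ K°)[X]` with `|f'(η)| = 1`, which is the vendored conclusion (with `f` mapped to
  `K[X]`, of least degree among the polynomials over `K_B` vanishing at `η`).
* `Temkin2013_Thm551iii_inertial.of_stabilityRational` — the same from
  `Kuhlmann2010StabilityRational` (`Kuhlmann2010Stability.of_rational`, the fundamental
  inequality being proved in the tree).
* `Temkin2013_Thm551iii.of_stability_of_normal` — Thm. 5.5.1 (iii) itself from
  `Kuhlmann2010Stability` and the normality of toric charts (`Temkin2013_toricChartNormal`), via
  `Temkin2013_Thm551iii.of_inertial_of_normal`.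

So the trust base of `Temkin2013_Thm551iii_inertial` is that of `Kuhlmann2010Stability`; the
discharge `Temkin2013_Thm551iii_inertial_holds` is one line once `Kuhlmann2010Stability_holds`
(or `Kuhlmann2010StabilityRational_holds`) lands.

## Sources

* M. Temkin, *Inseparable local uniformization*, J. Algebra 373 (2013) = arXiv:0804.1554v3:
  §2.1 and Remark 2.1.3 (p. 10), proof of Thm. 5.5.1 (iii) (p. 59).
* F.-V. Kuhlmann, *Elimination of ramification I: The generalized stability theorem*, Trans.
  AMS 362 (2010), Thm. 1.1.
-/

noncomputable section

namespace Literature.AlgebraicGeometry.Resolution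

open IsLocalRing ValuationSubring Polynomial Cardinal
open scoped IntermediateField

universe u

/-- **Temkin 2013, proof of Thm. 5.5.1 (iii), "`K°` is étale over `K°_B`", from the generalized
stability theorem.** PROVED: `Kuhlmann2010Stability → Temkin2013_Thm551iii_inertial`.
[cite: Temkin2013, proof of Thm. 5.5.1 (iii) (p. 59 of arXiv:0804.1554v3)] -/
theorem Temkin2013_Thm551iii_inertial.of_stability (hS : Kuhlmann2010Stability.{u}) :
    Temkin2013_Thm551iii_inertial.{u} := by
  intro k K _ _ _ hfg O hk hD E F x y hB hgen hsep
  classical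
  set KB : IntermediateField k K :=
    IntermediateField.adjoin k (Set.range (Sum.elim x fun i => (y i : K))) with hKBdef
  haveI : FiniteDimensional KB K :=
    finiteDimensional_adjoin_of_isTranscendenceBasis hfg _ hB.isTranscendenceBasis
  have hkB : ∀ c : k, algebraMap k KB c ∈ O.comap (algebraMap KB K) := algebraMap_mem_comap hk KB
  have hxB : ∀ j, x j ∈ KB := fun j => IntermediateField.subset_adjoin k _ ⟨Sum.inl j, rfl⟩
  have hyB : ∀ i, (y i : K) ∈ KB := fun i => IntermediateField.subset_adjoin k _ ⟨Sum.inr i, rfl⟩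
  -- (1) `K_B` is a finitely generated Abhyankar valued field, hence defectless
  have hfgB : (⊤ : IntermediateField k KB).FG :=
    IntermediateField.fg_top_iff.mpr (IntermediateField.essFiniteType_iff.mpr
      (IntermediateField.fg_adjoin_of_finite (Set.finite_range _)))
  have hN : Algebra.trdeg k K < ℵ₀ := trdeg_lt_aleph0_of_fg hfg
  have htrK : Algebra.trdeg k K = (E + F : ℕ) := by
    have h := hB.isTranscendenceBasis.lift_cardinalMk_eq_trdeg
    simp only [Cardinal.mk_fintype, Fintype.card_sum, Fintype.card_fin, Cardinal.lift_natCast,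
      Cardinal.lift_uzero] at h
    exact h.symm
  have htrB : Algebra.trdeg k KB = Algebra.trdeg k K := by
    have h := trdeg_add_eq k KB (A := K)
    rw [trdeg_eq_zero (R := KB) (A := K), add_zero] at h
    exact h
  have hDB : transcendenceDefect k (O.comap (algebraMap KB K)) hkB = 0 := by
    have hNB : Algebra.trdeg k KB < ℵ₀ := htrB ▸ hN
    refine (transcendenceDefect_eq_zero_iff _ hkB hNB).mpr (le_antisymm
      (ratRank_add_residueTrdeg_le_trdeg _ hkB) ?_)
    -- `E ≤ E(K_B)` and `F ≤ F(K_B)`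
    have hvi : IsValueIndependent O x :=
      (isValueIndependent_iff_linearIndependent O x hB.ne_zero).mpr hB.linearIndependent
    have hE' : (E : Cardinal) ≤ ratRank (O.comap (algebraMap KB K)) := by
      have h := (isValueIndependent_comap_iff O (fun j => (⟨x j, hxB j⟩ : KB))).mpr hvi
      exact h.natCast_le_ratRank
    have hF' : (F : Cardinal) ≤ residueTrdeg k (O.comap (algebraMap KB K)) hkB := by
      refine natCast_le_residueTrdeg_comap k O hk hkB (fun i => ⟨⟨(y i : K), hyB i⟩, (y i).2⟩) ?_
      have heq : (fun i => comapInclusion O (⟨⟨(y i : K), hyB i⟩, (y i).2⟩ :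
          O.comap (algebraMap KB K))) = y := funext fun i => Subtype.ext rfl
      have := hB.algebraicIndependent_residue
      rwa [← heq] at this
    rw [htrB, htrK]
    push_cast
    exact add_le_add hE' hF'
  have hdef : IsDefectlessField KB (O.comap (algebraMap KB K)) := hS k KB hfgB _ hkB hDB
  -- (2) `|K_B^×| = |K^×|`
  have hEB : valueSubgroup KB O = ⊤ := by
    rw [_root_.eq_top_iff, ← hgen]
    refine (Subgroup.closure_le _).mpr ?_
    rintro _ ⟨j, rfl⟩
    exact (mem_valueSubgroup_iff KB O _).mpr ⟨⟨x j, hxB j⟩, fun h => hB.ne_zero j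
      (congrArg Subtype.val h), rfl⟩
  -- (3) the residue field of `O` is separable over that of `O ∩ K_B ⊇ k(ỹ)`
  letI := algebraOfMem k O hk
  have hle : (IntermediateField.adjoin k (Set.range fun i => residue O (y i))).toSubfield ≤
      residueSubfield KB O := by
    rw [IntermediateField.adjoin_toSubfield]
    refine Subfield.closure_le.mpr (Set.union_subset ?_ ?_)
    · rintro _ ⟨c, rfl⟩
      exact (mem_residueSubfield_iff KB O _).mpr ⟨algebraMap k KB c, hkB c, rfl⟩
    · rintro _ ⟨i, rfl⟩
      exact (mem_residueSubfield_iff KB O _).mpr ⟨⟨(y i : K), hyB i⟩, (y i).2, rfl⟩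
  have hsepB : ∀ r : ResidueField O, IsSeparable (residueSubfield KB O) r := fun r =>
    isSeparable_of_subfield_le hle (hsep r)
  -- (4) the generator
  obtain ⟨η, hηO, htop, hcoef, hder⟩ :=
    exists_generator_valuation_derivative_eq_one (F := KB) O hdef hEB hsepB
  refine ⟨η, hηO, ?_, (minpoly KB η).map (algebraMap KB K), (minpoly.monic
    (Algebra.IsIntegral.isIntegral η)).map _, ?_, ?_, ?_, ?_⟩
  · have h := congrArg (IntermediateField.restrictScalars k) htop
    rwa [IntermediateField.adjoin_adjoin_left, IntermediateField.restrictScalars_top] at h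
  · rw [eval_map, ← aeval_def, minpoly.aeval]
  · intro i
    rw [coeff_map]
    exact ⟨((minpoly KB η).coeff i).2, hcoef i⟩
  · intro q hq hq0 hqη
    obtain ⟨Q, hQ, -⟩ := exists_map_eq_of_forall_coeff_mem' KB q hq
    have hQ0 : Q ≠ 0 := fun h => hq0 (by rw [← hQ, h, Polynomial.map_zero])
    have hQη : aeval η Q = 0 := by rw [aeval_def, ← eval_map, hQ, hqη]
    rw [natDegree_map_eq_of_injective (algebraMap KB K).injective, ← hQ,
      natDegree_map_eq_of_injective (algebraMap KB K).injective]
    exact natDegree_le_of_dvd (minpoly.dvd KB η hQη) hQ0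
  · rw [derivative_map, eval_map, ← aeval_def]
    exact hder

/-- **Temkin 2013, "`K°` is étale over `K°_B`", from the rational case of the generalized stability
theorem** (`Kuhlmann2010StabilityRational`, to which `Kuhlmann2010Stability` reduces by
`Kuhlmann2010Stability.of_rational`, the fundamental inequality being proved).
[cite: Temkin2013, proof of Thm. 5.5.1 (iii) (p. 59 of arXiv:0804.1554v3)] -/
theorem Temkin2013_Thm551iii_inertial.of_stabilityRational
    (hR : Kuhlmann2010StabilityRational.{u}) : Temkin2013_Thm551iii_inertial.{u} :=
  Temkin2013_Thm551iii_inertial.of_stability (Kuhlmann2010Stability.of_rational hR)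

/-- **Temkin 2013, "`K°` is étale over `K°_B`", from Kuhlmann's Thm. 1.1 in transcendence degree
one with a value-transcendental generator** (`Kuhlmann2010StabilityValueTranscendental`, the
current trust base of `Kuhlmann2010Stability` in the tree,
`Kuhlmann2010Stability.of_stabilityValueTranscendental`).
[cite: Temkin2013, proof of Thm. 5.5.1 (iii) (p. 59 of arXiv:0804.1554v3)] -/
theorem Temkin2013_Thm551iii_inertial.of_stabilityValueTranscendental
    (hVT : Kuhlmann2010StabilityValueTranscendental.{u}) : Temkin2013_Thm551iii_inertial.{u} :=
  Temkin2013_Thm551iii_inertial.of_stability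
    (Kuhlmann2010Stability.of_stabilityValueTranscendental hVT)

/-- **Temkin 2013, Thm. 5.5.1 (iii) from the generalized stability theorem and the normality of
toric charts.** [cite: Temkin2013, Thm. 5.5.1 (iii) (p. 59 of arXiv:0804.1554v3)] -/
theorem Temkin2013_Thm551iii.of_stability_of_normal (hS : Kuhlmann2010Stability.{u})
    (h₂ : Temkin2013_toricChartNormal.{u}) : Temkin2013_Thm551iii.{u} :=
  Temkin2013_Thm551iii.of_inertial_of_normal (Temkin2013_Thm551iii_inertial.of_stability hS) h₂

end Literature.AlgebraicGeometry.Resolution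

end
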